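import Mathlib
import Summits.NavierStokesRegularity.NavierStokesRegularity.Theorems.TaoLadderRungTwoBreakOneShiftTailEstimates
import HarnessLib

/-!
# Kernel STAGE 3, self-map rows: STAGE 2's Lemma 4 in the kernel (the tail clamps are inactive), rates
# from amplitudes, and the end-to-end statement with the tail side fully derived
# (cell harvest/h2-tao-ladder, seat p2; rung1/KERNEL-STAGE3-PLAN.md; support for K1(1) = `NoSurvivingDSSOne`,
# stmt-NavierStokesRegularity-20205)

MODEL lattice ODEs only (Tao 2016 §4 on Tao's shift set `S`); nothing here is a statement about the
Navier–Stokes equations; no item is closed; CONDITIONAL glue.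

* `abs_fullFamily_le_of_tubes` — amplitudes along the flight: tail shells from the tubes, window shells from a
  hull hypothesis (the engine's `umax`);
* `abs_quadTerm_fullFamily_le` — rate of the quadratic field from amplitudes (tree `abs_quadTerm_le_of_bounds`);
* `tailRaw_mem_tube_of_rows` — STAGE 2 Lemma 4 (a)/(b): the raw Picard–shift output of a tail shell stays in its
  tube when `g_hi tubeR_{k+1} + dev_k + τ_hi R_k ≤ tubeR_k` (partner a tail shell; `dev_k ≥ |g tubeC_{k+1} −
  tubeC_k|`) resp. `A₁ + τ_hi R_{−1} ≤ tubeR_{−1}` (partner = the window bottom, `A₁` = the engine's «STAGE2 wake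
  entry» bound);
* `exists_surviving_dssWave_of_windowCert_v3` — the end-to-end theorem whose hypotheses are: the window
  certificate; window-side numbers in solved form ((H-win) box inclusion, the raw window block's Lipschitz
  constant, `γ`, `Z₀`, `Dwin`, window hulls, `A₁`, the `g`-enclosure); table-arithmetic rows (rates, contraction
  rows, self-map rows, centre mismatch); frame inequalities; a point of the invariant set.
-/

noncomputable section

-- `Summit.NavierStokesRegularity.NavierStokesRegularity.…` is the tree's (summit = problem) namespace; the
-- duplicated component is intended, so the dupNamespace linter is silenced for this file.
set_option linter.dupNamespace false

namespace Summit.NavierStokesRegularity.NavierStokesRegularity.Theorems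

namespace DSSOneShift

open Set MeasureTheory intervalIntegral
open Literature.Analysis.FluidPDE Literature.Analysis.FluidPDE.TaoCascade CertificateGlueOn

variable {m : ℕ}

namespace OneShiftFrame

variable (F : OneShiftFrame m)

/-! ### Self-map rows and rates from amplitudes -/

/-- **Amplitudes along the flight from the tubes (tail shells) and a window hull (window shells).** [folklore] -/
theorem abs_fullFamily_le_of_tubes {ε₀ : ℝ} {α : Fin m → Fin m → Fin m → ℤ × ℤ × ℤ → ℝ}
    (cert : OneShiftWindowCert F ε₀ α) (A : ℤ → ℝ)
    (hAtail : ∀ j k', ¬ F.InWindow k' → |F.tubeC j k'| + F.tubeR k' ≤ A k')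
    (hAwin : ∀ w, F.Adm w → ∀ j k', F.InWindow k' → ∀ s ∈ Icc 0 F.τhi, |F.fullFamily cert w j k' s| ≤ A k')
    {w : F.Space} (hw : F.Adm w) (j : Fin m) (k' : ℤ) {s : ℝ} (hs : s ∈ Icc 0 F.τhi) :
    |F.fullFamily cert w j k' s| ≤ A k' := by
  by_cases hk : F.InWindow k'
  · exact hAwin w hw j k' hk s hs
  · rw [F.fullFamily_tail cert hw j hk]
    have htube := (F.admData_decode hw).2.2 j k' hk s hs
    have := abs_sub_abs_le_abs_sub (F.decodeTail w j k' s) (F.tubeC j k')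
    linarith [hAtail j k' hk]

/-- **Rate bound of the quadratic field along the flight from amplitude bounds** (`A ≥ 0`, `|α| ≤ M_α`):
`|quadTerm_{i,k}(S)(s)| ≤ m² M_α ((1+ε₀)^{5k/2}(A_k² + 2A_kA_{k+1}) + (1+ε₀)^{5(k-1)/2} A_{k-1}²)`.
[cite: Tao2016AveragedNS, §4 Lemma 4.1 (4.8); tree lemma `abs_quadTerm_le_of_bounds`] -/
theorem abs_quadTerm_fullFamily_le {ε₀ Mα : ℝ} {α : Fin m → Fin m → Fin m → ℤ × ℤ × ℤ → ℝ}
    (cert : OneShiftWindowCert F ε₀ α) (hε : 0 < 1 + ε₀) (hMα : 0 ≤ Mα)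
    (hα : ∀ i₁ i₂ i₃ μ, |α i₁ i₂ i₃ μ| ≤ Mα) (A : ℤ → ℝ) (hA0 : ∀ k, 0 ≤ A k)
    (hA : ∀ w, F.Adm w → ∀ j k', ∀ s ∈ Icc 0 F.τhi, |F.fullFamily cert w j k' s| ≤ A k')
    {w : F.Space} (hw : F.Adm w) (i : Fin m) (k : ℤ) {s : ℝ} (hs : s ∈ Icc 0 F.τhi) :
    |quadTerm ε₀ α (F.fullFamily cert w) i k s| ≤
      (m : ℝ) ^ 2 * Mα * ((1 + ε₀) ^ ((5 : ℝ) * k / 2) * (A k * A k + 2 * (A k * A (k + 1))) +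
        (1 + ε₀) ^ ((5 : ℝ) * ((k : ℝ) - 1) / 2) * (A (k - 1) * A (k - 1))) :=
  abs_quadTerm_le_of_bounds hε.le hMα hα (F.fullFamily cert w) i k s (hA0 k) (hA0 (k - 1))
    (fun j => hA w hw j (k - 1) s hs) (fun j => hA w hw j k s hs) (fun j => hA w hw j (k + 1) s hs)

/-- **SELF-MAP ROWS ⟹ the tail clamps are inactive** (STAGE 2 Lemma 4 (a)/(b) in the kernel). For an
admissible `u` and a tail shell `k`: if the renormalisation factor lies in `[0, g_hi]`, the one-shift partner
`k+1` is a tail shell whose tube maps into shell `k`'s tube (`g_hi tubeR_{k+1} + dev_k + τ_hi R_k ≤ tubeR_k`,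
`dev_k ≥ |g·tubeC_{k+1} − tubeC_k|`), or `k = -1` and the window's wake entry obeys `A₁ + τ_hi R_{-1} ≤
tubeR_{-1}` (`A₁ ≥ |g z_0 − tubeC_{-1}|`, the engine's «STAGE2 wake entry» line), then
`|tailRaw u i k t − tubeC i k| ≤ tubeR k` on the flight.
[cite: Tao2016AveragedNS, §4 Lemma 4.1 (4.8); cell vocabulary, harvest/h2-tao-ladder rung1/STAGE2-LEMMA.md §3 Lemma 4(a)(b)] -/
theorem tailRaw_mem_tube_of_rows {ε₀ : ℝ} {α : Fin m → Fin m → Fin m → ℤ × ℤ × ℤ → ℝ}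
    (cert : OneShiftWindowCert F ε₀ α) (R devC : ℤ → ℝ) {gHi A1 : ℝ}
    (hR : ∀ u, F.Adm u → ∀ i k, ¬ F.InWindow k → ∀ s ∈ Icc 0 F.τhi,
      |quadTerm ε₀ α (F.fullFamily cert u) i k s| ≤ R k)
    (hg0 : ∀ w, F.Adm w → 0 ≤ gfac (slice (F.fullFamily cert w) (F.decodeTau w)) ∧
      gfac (slice (F.fullFamily cert w) (F.decodeTau w)) ≤ gHi)
    (hdev : ∀ w, F.Adm w → ∀ i k, ¬ F.InWindow k → ¬ F.InWindow (k + 1) →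
      |gfac (slice (F.fullFamily cert w) (F.decodeTau w)) * F.tubeC i (k + 1) - F.tubeC i k| ≤ devC k)
    (hA1 : ∀ w, F.Adm w → ∀ i,
      |gfac (slice (F.fullFamily cert w) (F.decodeTau w)) * F.fullFamily cert w i 0 (F.decodeTau w) -
        F.tubeC i (-1)| ≤ A1)
    (hrows : ∀ k, ¬ F.InWindow k → ¬ F.InWindow (k + 1) →
      gHi * F.tubeR (k + 1) + devC k + F.τhi * R k ≤ F.tubeR k)
    (hrow1 : A1 + F.τhi * R (-1) ≤ F.tubeR (-1))
    {u : F.Space} (hu : F.Adm u) (i : Fin m) {k : ℤ} (hk : ¬ F.InWindow k) {t : ℝ}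
    (ht : t ∈ Icc 0 F.τhi) : |F.tailRaw cert u i k t - F.tubeC i k| ≤ F.tubeR k := by
  rw [F.tailRaw_eq cert hu]
  set S := F.fullFamily cert u
  set g := gfac (slice S (F.decodeTau u))
  obtain ⟨hg0', hg1'⟩ := hg0 u hu
  -- the Picard integral is at most `τ_hi R_k`
  have hcont : ContinuousOn (fun x => quadTerm ε₀ α S i k x) (Icc 0 F.τhi) :=
    continuousOn_quadTerm (fun j k' => F.continuousOn_fullFamily cert hu j k') i k
  have h0 : (0 : ℝ) ∈ Icc 0 F.τhi := left_mem_Icc.2 F.τhi_pos.le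
  have hint : |∫ s in (0 : ℝ)..t, quadTerm ε₀ α S i k s| ≤ F.τhi * R k := by
    have hb : ∀ x ∈ Set.uIoc (0 : ℝ) t, ‖quadTerm ε₀ α S i k x‖ ≤ R k := by
      intro x hx; rw [Real.norm_eq_abs]
      exact hR u hu i k hk x (uIcc_subset_Icc h0 ht (uIoc_subset_uIcc hx))
    have h := intervalIntegral.norm_integral_le_of_norm_le_const hb
    rw [Real.norm_eq_abs, sub_zero, abs_of_nonneg ht.1] at h
    have hR0 : 0 ≤ R k := (abs_nonneg _).trans (hR u hu i k hk 0 h0)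
    calc |∫ s in (0 : ℝ)..t, quadTerm ε₀ α S i k s| ≤ R k * t := h
      _ ≤ R k * F.τhi := mul_le_mul_of_nonneg_left ht.2 hR0
      _ = F.τhi * R k := mul_comm _ _
  have hsplit : g * S i (k + 1) (F.decodeTau u) + (∫ s in (0 : ℝ)..t, quadTerm ε₀ α S i k s) - F.tubeC i k =
      (g * S i (k + 1) (F.decodeTau u) - F.tubeC i k) + ∫ s in (0 : ℝ)..t, quadTerm ε₀ α S i k s := by ring
  rw [hsplit]
  refine (abs_add_le _ _).trans ?_
  by_cases hk1 : F.InWindow (k + 1)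
  · -- the partner is the window bottom: `k = -1`
    have hk0 : k = -1 := by unfold InWindow at hk hk1; omega
    subst hk0
    have h := hA1 u hu i
    norm_num at h ⊢
    linarith [hint]
  · have htube := (F.admData_decode hu).2.2 i (k + 1) hk1 _ (F.decodeTau_mem hu)
    rw [← F.fullFamily_tail cert hu i hk1] at htube
    have hid : g * S i (k + 1) (F.decodeTau u) - F.tubeC i k =
        g * (S i (k + 1) (F.decodeTau u) - F.tubeC i (k + 1)) + (g * F.tubeC i (k + 1) - F.tubeC i k) := by
      ring
    have h1 : |g * S i (k + 1) (F.decodeTau u) - F.tubeC i k| ≤ gHi * F.tubeR (k + 1) + devC k := by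
      rw [hid]
      refine (abs_add_le _ _).trans (add_le_add ?_ (hdev u hu i k hk hk1))
      rw [abs_mul, abs_of_nonneg hg0']
      exact mul_le_mul hg1' htube (abs_nonneg _) (hg0'.trans hg1')
    linarith [hrows k hk hk1]


/-- **KERNEL STAGE 3 — end-to-end with the tail side fully derived.** Hypotheses are now: the window
certificate; WINDOW-SIDE numbers in solved form (raw window block `q`-Lipschitz; `γ`, `Z₀`, `Dwin`; window
amplitudes `A` on window shells; the wake entry `A₁`; the raw window output in the box = (H-win); the
renormalisation-factor enclosure); TABLE ARITHMETIC rows (rates `R` dominate the amplitude expression; the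
contraction rows; the self-map rows = STAGE 2 Lemma 4; the centre mismatch `dev`); and the FRAME inequalities
(tube amplitudes, wake tubes under `Qβⁿ`, top tubes under `C₀ϱ^{W+j}`, a bottom box interval avoiding `0`, a
point of the invariant set). Conclusion: a non-trivial (S₁)-surviving admissible DSS wave.
[cite: Tao2016AveragedNS, §4 Lemma 4.1 (4.8), §5.3–§6; cell vocabulary, harvest/h2-tao-ladder rung1/STAGE2-LEMMA.md, rung1/STAGE3-BANACH.md, rung1/KERNEL-STAGE3-PLAN.md] -/
theorem exists_surviving_dssWave_of_windowCert_v3 {ε₀ Mα Q β C₀ ϱ q gHi γ Z0 A1 : ℝ}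
    {α : Fin m → Fin m → Fin m → ℤ × ℤ × ℤ → ℝ} (cert : OneShiftWindowCert F ε₀ α)
    (R A Dwin devC : ℤ → ℝ)
    (hε : 0 < 1 + ε₀) (hMα : 0 ≤ Mα) (hα : ∀ i₁ i₂ i₃ μ, |α i₁ i₂ i₃ μ| ≤ Mα) (hW1 : 1 ≤ F.W)
    (hq : 0 ≤ q) (hq1 : q < 1) (hA0 : ∀ k, 0 ≤ A k)
    (hAtail : ∀ j k', ¬ F.InWindow k' → |F.tubeC j k'| + F.tubeR k' ≤ A k')
    (hAwin : ∀ w, F.Adm w → ∀ j k', F.InWindow k' → ∀ s ∈ Icc 0 F.τhi, |F.fullFamily cert w j k' s| ≤ A k')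
    (hRrow : ∀ k : ℤ, (m : ℝ) ^ 2 * Mα * ((1 + ε₀) ^ ((5 : ℝ) * k / 2) * (A k * A k + 2 * (A k * A (k + 1))) +
        (1 + ε₀) ^ ((5 : ℝ) * ((k : ℝ) - 1) / 2) * (A (k - 1) * A (k - 1))) ≤ R k)
    (hg0 : ∀ w, F.Adm w → 0 ≤ gfac (slice (F.fullFamily cert w) (F.decodeTau w)) ∧
      gfac (slice (F.fullFamily cert w) (F.decodeTau w)) ≤ gHi)
    (hγ : ∀ u v, F.AdmLip R u → F.AdmLip R v →
      |gfac (slice (F.fullFamily cert u) (F.decodeTau u)) -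
        gfac (slice (F.fullFamily cert v) (F.decodeTau v))| ≤ γ * dist u v)
    (hZ0 : ∀ u v, F.AdmLip R u → F.AdmLip R v → ∀ i,
      |F.fullFamily cert u i 0 (F.decodeTau u) - F.fullFamily cert v i 0 (F.decodeTau v)| ≤ Z0 * dist u v)
    (hDwin : ∀ u v, F.AdmLip R u → F.AdmLip R v → ∀ j k', F.InWindow k' → ∀ s ∈ Icc 0 F.τhi,
      |F.fullFamily cert u j k' s - F.fullFamily cert v j k' s| ≤ Dwin k' * dist u v)
    (hrow : ∀ i k, ¬ F.InWindow k →
      gHi * (if F.InWindow (k + 1) then Z0 else F.wt (k + 1) + R (k + 1) * F.rτ) + A (k + 1) * γ +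
        F.τhi * quadTermLip ε₀ α A (fun k' => if F.InWindow k' then Dwin k' else F.wt k') i k ≤
        q * F.wt k)
    (hW : ∀ u v, F.AdmLip R u → F.AdmLip R v →
      dist (F.rawWindow cert u) (F.rawWindow cert v) ≤ q * dist u v)
    (h0 : ∃ u, F.AdmLip R u)
    (hwinIn : ∀ u, F.AdmLip R u →
      (∀ i k, |(F.rawWindow cert u).1 i k| ≤ 1) ∧ |(F.rawWindow cert u).2| ≤ 1)
    (hdev : ∀ w, F.Adm w → ∀ i k, ¬ F.InWindow k → ¬ F.InWindow (k + 1) →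
      |gfac (slice (F.fullFamily cert w) (F.decodeTau w)) * F.tubeC i (k + 1) - F.tubeC i k| ≤ devC k)
    (hA1 : ∀ w, F.Adm w → ∀ i,
      |gfac (slice (F.fullFamily cert w) (F.decodeTau w)) * F.fullFamily cert w i 0 (F.decodeTau w) -
        F.tubeC i (-1)| ≤ A1)
    (hrows : ∀ k, ¬ F.InWindow k → ¬ F.InWindow (k + 1) →
      gHi * F.tubeR (k + 1) + devC k + F.τhi * R k ≤ F.tubeR k)
    (hrow1 : A1 + F.τhi * R (-1) ≤ F.tubeR (-1))
    (hg : ∀ u, F.AdmLip R u →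
      1 < gfac (slice (F.fullFamily cert u) (F.decodeTau u)) ^ 2 ∧
        gfac (slice (F.fullFamily cert u) (F.decodeTau u)) ^ 2 ≤ 1 + ε₀ ∧
        gfac (slice (F.fullFamily cert u) (F.decodeTau u)) < bigLam ε₀ ∧
        β ^ 2 < gfac (slice (F.fullFamily cert u) (F.decodeTau u)) * bigLam ε₀)
    (hQA : A 0 ≤ Q) (hβ1 : 1 ≤ β)
    (hwakeTube : ∀ i (n : ℕ), 1 ≤ n → |F.tubeC i (-(n : ℤ))| + F.tubeR (-(n : ℤ)) ≤ Q * β ^ n)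
    (hϱ : 0 < ϱ) (hϱ1 : ϱ * bigLam ε₀ < 1) (hC₀ : 0 ≤ C₀)
    (htopTube : ∀ i (j : ℕ), |F.tubeC i ((F.W : ℤ) + j)| + F.tubeR ((F.W : ℤ) + j) ≤ C₀ * ϱ ^ (F.W + j))
    (hne : ∃ i, F.a i 0 < |F.yc i 0|) :
    ∃ (T : ℝ) (Φ : Unit → ℝ → Em m), 0 < T ∧ IsDSSWave ε₀ α (Equiv.refl Unit) T Φ ∧ Surviving 1 ε₀ T ∧
      ∃ x, Φ () x ≠ 0 := by
  have hA : ∀ w, F.Adm w → ∀ j k', ∀ s ∈ Icc 0 F.τhi, |F.fullFamily cert w j k' s| ≤ A k' :=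
    fun w hw j k' s hs => F.abs_fullFamily_le_of_tubes cert A hAtail hAwin hw j k' hs
  have hR : ∀ u, F.Adm u → ∀ i k, ¬ F.InWindow k → ∀ s ∈ Icc 0 F.τhi,
      |quadTerm ε₀ α (F.fullFamily cert u) i k s| ≤ R k :=
    fun u hu i k _ s hs => (F.abs_quadTerm_fullFamily_le cert hε hMα hα A hA0 hA hu i k hs).trans (hRrow k)
  have hR0 : ∀ k, 0 ≤ R k := fun k => by
    refine le_trans ?_ (hRrow k)
    have := hA0 k; have := hA0 (k + 1); have := hA0 (k - 1)
    have h1 : 0 ≤ (1 + ε₀) ^ ((5 : ℝ) * k / 2) := Real.rpow_nonneg hε.le _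
    have h2 : 0 ≤ (1 + ε₀) ^ ((5 : ℝ) * ((k : ℝ) - 1) / 2) := Real.rpow_nonneg hε.le _
    positivity
  have htailIn : ∀ u, F.AdmLip R u → ∀ i k, ¬ F.InWindow k → ∀ t ∈ Icc 0 F.τhi,
      |F.tailRaw cert u i k t - F.tubeC i k| ≤ F.tubeR k :=
    fun u hu i k hk t ht => F.tailRaw_mem_tube_of_rows cert R devC hR hg0 hdev hA1 hrows hrow1 hu.1 i hk ht
  have hhull0 : ∀ u, F.AdmLip R u → ∀ i, ∀ s ∈ Icc 0 F.τhi, |F.fullFamily cert u i 0 s| ≤ Q :=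
    fun u hu i s hs => (hAwin u hu.1 i 0 ⟨le_rfl, by exact_mod_cast hW1⟩ s hs).trans hQA
  exact F.exists_surviving_dssWave_of_windowCert_rows cert R A Dwin hε hMα hα hW1 hq hq1 hR0 hR hA hg0 hγ hZ0
    hDwin hrow hW h0 hwinIn htailIn hg ((hA0 0).trans hQA) hβ1 hwakeTube hhull0 hϱ hϱ1 hC₀ htopTube hne


end OneShiftFrame

end DSSOneShift

end Summit.NavierStokesRegularity.NavierStokesRegularity.Theorems
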